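import Literature.MathematicalPhysics.QuantumFieldTheory.Balaban1983to89.B8Thm4SupportLocalBdryGR129
import Literature.MathematicalPhysics.QuantumFieldTheory.Balaban1983to89.B8Thm4TruncationLocalRec

/-!
# `Balaban1983to89.B8Thm4SupportLocalBdryRec` — RECORD TWIN of `B8Thm4SupportLocalBdry` §1 ∕ `B8Thm4SupportLocalBdryG` §1 ([Balaban1985RegularSpaces] THEOREM 4 (p. 88):
# the level induction with the support invariant (and the `G`-valued invariant)) for the SYMMETRISED CENTRED block averaging (0.4) of [Balaban1987RG1] — the
# (1.29) letter read as n05-d's record twin `Restr129Z`; ONE `exact` each from ✓`B8Thm4SupportLocalBdryGR129`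

statement-level skeleton of published theorems with citation tags; proofs where landed; nothing here is a claim about the Yang–Mills mass gap

T. Bałaban, *Spaces of regular gauge field configurations on a lattice and gauge fixing conditions*, Commun. Math. Phys. **99** (1985) 75–102
`[Balaban1985RegularSpaces]` ("[6]"): Thm 4 p. 88, proof pp. 88–89 + 94–95, Prop. 5 p. 94, Prop. 3 p. 87, (1.17) p. 78, (1.29) p. 81, p. 76 («G = SU(N)»); T. Bałaban,
*Renormalization group approach to lattice gauge field theories. I*, Commun. Math. Phys. **109** (1987) 249–301 `[Balaban1987RG1]` ("[I]"): (0.4) p. 253, pp. 253–254.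
STATUS: published, refereed.

CITATION HEADER (lean-in-tree rule).  Cell `pub-ymgap`, base `pub-ymgap-dag-n05-c` g26 — N05-REC stage 2 (director-ym №254∕№255), item R5 sub-chain α, LEAD PEN
dag-n05-e g35 (inventory `N05-REC-INVENTORY.md` e50db04501ab292d §R5 row `B8Thm4SupportLocalBdry`: A `thm4_exists_all_levels_supp_bdry`).  WHAT IS REPRODUCED =
✓`B8Thm4SupportLocalBdry.thm4_exists_all_levels_supp_bdry` and ✓`B8Thm4SupportLocalBdryG.thm4_exists_all_levels_supp_bdry_mem` with `Restr129 ↦ Restr129Z` (n05-d's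
twin of `B8Eq119TwistedAxial.Restr129` over `zdBlockingZ ∕ bgTZ`), declaration names kept (T5); each is the landed abstract-letter driver
`B8Thm4SupportLocalBdryGR129.thm4_exists_all_levels_supp_bdry_mem_R129` at `R m u := Restr129Z L m (Λs m) U₀ u`, `R 0 1 := B8Thm4TruncationLocalRec.restr129Z_one`.
Kind «kernel-checked proof», theorems only; no `def`, no `instance`, no `notation`, no existing module modified.  `--supports stmt-QuantumFields-20541` (K0⁷-keyed,
COUNT-NEUTRAL).

HONEST SCOPE: bookkeeping over landed theorems; Propositions 3 ∕ 5 are NOT proved (sockets displayed); the composition with the edition-γ in-edge (the engine's §2,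
`B8Thm4KLevelGamma`) is NOT twinned here (R5 sub-chain β∕α-§2, after R1∕R4); `HThm4Rec` UNDISCHARGED; caveat (C-S3-1) stands; N05 [B8] DISCHARGED OF RECORD
untouched; COUNT 7∕28 (7∕27 excl. NODE O) · K 1∕4 UNMOVED; one finite `𝕋⁴` programme at fixed `ε`, Bałaban AS PRINTED; nothing continuum ∕ ℝ⁴ ∕ OS ∕ mass-gap ∕
Clay.  No `sorry`, no `def`.

[cite: Balaban1985RegularSpaces, Thm 4 p.88, proof pp.88–89 + 94–95, Prop. 5 (1.107)–(1.108) p.94, Prop. 3 p.87, (1.17) p.78, (1.29) p.81, p.76; Balaban1987RG1, (0.4) p.253, pp.253–254]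
-/

noncomputable section

open NormedSpace

namespace Literature.MathematicalPhysics.QuantumFieldTheory.Balaban1983to89.B8Thm4SupportLocalBdryRec

open Complex (I)
open MatrixLog B7Prop1Explicit B7Prop2Explicit B7Prop1Local B7Eq92Concrete
open B8Ineq132 (covDerivFwd)
open B8Eq184Proof (gaugeExp cfgExp)
open B8Eq119TwistedAxialRec (Restr129Z)
open B8Thm4TruncationLocalRec (restr129Z_one)
open B8Thm4SupportLocalBdryGR129 (thm4_exists_all_levels_supp_bdry_mem_R129)

-- `Site` alone could resolve to the torus sites of `Setup.lean`; re-export the `ℤ^d` sites of `B7Prop1Explicit`.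
export B7Prop1Explicit (Site)

variable {d : ℕ}

section Main

variable {𝔸 : Type*} [CStarAlgebra 𝔸] [Nontrivial 𝔸]
variable {L k : ℕ} {η : ℝ} {U₀ U' : Site d → Fin d → 𝔸ˣ} {a cstar α₄ : ℝ}

/-- ★★ **THEOREM 4's LEVEL INDUCTION WITH THE SUPPORT INVARIANT AND THE GAUGE-GROUP INVARIANT, RECORD STRUCTURE** (twin of
✓`B8Thm4SupportLocalBdryG.thm4_exists_all_levels_supp_bdry_mem`, the (1.29) letter = `Restr129Z` over the centred (0.4) averaging): sockets `hP5base`∕`hP5` ask for ∕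
deliver a `G`-valued `v` with `v = 1` off `S` and (1.29) for `1·v` ∕ `u₁·v`; the Proposition-3 reset `hP3` reads (1.29) and the support clause; conclusion at every
`m ≤ k`: a `G`-valued `u`, `u = 1` off `S`, `Restr129Z L m (Λs m) U₀ u`, `W = U′^{u⁻¹}` in the gauge `Lan m`, its exponent in the (1.69)∕`c⋆` shape on `E_j`, `j ≤ m`.
ONE `exact`: the abstract-letter driver at `R m u := Restr129Z L m (Λs m) U₀ u`, `R 0 1 := restr129Z_one`.
[cite: Balaban1985RegularSpaces, Thm 4 p.88, proof pp.88–89 + 94–95, Prop. 5 (1.107)–(1.108) p.94, Prop. 3 p.87, (1.17) p.78, (1.29) p.81, p.76 («G = SU(N)»); Balaban1987RG1, pp.253–254] -/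
theorem thm4_exists_all_levels_supp_bdry_mem (hL1 : 1 ≤ L) (hη : 0 < η) (S : Set (Site d)) (G : Subgroup 𝔸ˣ) (hG : G ≤ unitaryUnits 𝔸)
    (hU₀ : ∀ x κ, U₀ x κ ∈ unitaryUnits 𝔸) (hU' : ∀ x κ, U' x κ ∈ unitaryUnits 𝔸)
    (hcstar : 0 ≤ cstar) (hα₄ : 0 ≤ α₄) (hs₁ : α₄ ≤ 1 / 84) (hs₂ : L * cstar ≤ 1 / 12) (ha : a ≤ 1 / 4) (ha2 : 2 * a ≤ cstar)
    (E : ℕ → Set (Site d × Fin d)) (hE : ∀ j, E (j + 1) ⊆ E j)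
    (h66 : ∀ b ∈ E 0, ‖((U' b.1 b.2 : 𝔸ˣ) : 𝔸) - 1‖ ≤ a)
    (Λs : ℕ → ℕ → Set (Site d)) (Lan : ℕ → (Site d → Fin d → 𝔸ˣ) → Prop)
    (hP5base : ∃ (v : Site d → 𝔸ˣ) (lam : Site d → 𝔸), (∀ x, v x ∈ G) ∧ (∀ x, x ∉ S → v x = 1) ∧
        (∀ j, j ≤ 1 → ∀ b ∈ E j, (v b.1 : 𝔸) = ((gaugeExp lam b.1 : 𝔸ˣ) : 𝔸) ∧
          (v (b.1 + e b.2) : 𝔸) = ((gaugeExp lam (b.1 + e b.2) : 𝔸ˣ) : 𝔸)) ∧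
        (∀ j, j ≤ 1 → ∀ b ∈ E j, ‖lam b.1‖ ≤ α₄ ∧ ((L : ℝ) ^ j * η) * ‖covDerivFwd η U₀ b.2 lam b.1‖ ≤ α₄) ∧
        Lan 1 (mgauge U₀ v⁻¹ U') ∧ Restr129Z L 1 (Λs 1) U₀ ((1 : Site d → 𝔸ˣ) * v))
    (hP5 : ∀ m, 1 ≤ m → m < k → ∀ (u₁ : Site d → 𝔸ˣ) (U₁ : Site d → Fin d → 𝔸ˣ) (A : Site d → Fin d → 𝔸),
      (∀ x, u₁ x ∈ G) → (∀ x, x ∉ S → u₁ x = 1) → mgauge U₀ u₁ U₁ = U' → Restr129Z L m (Λs m) U₀ u₁ → Lan m U₁ →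
      (∀ j, j ≤ m → ∀ b ∈ E j, U₁ b.1 b.2 = cfgExp η A b.1 b.2 ∧ IsSelfAdjoint (A b.1 b.2) ∧ ‖A b.1 b.2‖ ≤ cstar * ((L : ℝ) ^ j * η)⁻¹) →
      ∃ (v : Site d → 𝔸ˣ) (lam : Site d → 𝔸), (∀ x, v x ∈ G) ∧ (∀ x, x ∉ S → v x = 1) ∧
        (∀ j, j ≤ m + 1 → ∀ b ∈ E j, (v b.1 : 𝔸) = ((gaugeExp lam b.1 : 𝔸ˣ) : 𝔸) ∧
          (v (b.1 + e b.2) : 𝔸) = ((gaugeExp lam (b.1 + e b.2) : 𝔸ˣ) : 𝔸)) ∧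
        (∀ j, j ≤ m + 1 → ∀ b ∈ E j, ‖lam b.1‖ ≤ α₄ ∧ ((L : ℝ) ^ j * η) * ‖covDerivFwd η U₀ b.2 lam b.1‖ ≤ α₄) ∧
        Lan (m + 1) (mgauge U₀ v⁻¹ U₁) ∧ Restr129Z L (m + 1) (Λs (m + 1)) U₀ (u₁ * v))
    (hP3 : ∀ m, 1 ≤ m → m ≤ k → ∀ (u : Site d → 𝔸ˣ) (W : Site d → Fin d → 𝔸ˣ) (A : Site d → Fin d → 𝔸),
      (∀ x, u x ∈ unitaryUnits 𝔸) → (∀ x, x ∉ S → u x = 1) → mgauge U₀ u W = U' → Restr129Z L m (Λs m) U₀ u → Lan m W →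
      (∀ j, j ≤ m → ∀ b ∈ E j, W b.1 b.2 = cfgExp η A b.1 b.2 ∧ ‖A b.1 b.2‖ ≤ (2 * (L * cstar) + 8 * α₄) * ((L : ℝ) ^ j * η)⁻¹) →
      ∀ j, j ≤ m → ∀ b ∈ E j, ‖A b.1 b.2‖ ≤ cstar * ((L : ℝ) ^ j * η)⁻¹) :
    ∀ m, m ≤ k → ∃ u : Site d → 𝔸ˣ, (∀ x, u x ∈ G) ∧ (∀ x, x ∉ S → u x = 1) ∧ Restr129Z L m (Λs m) U₀ u ∧
      ∃ W : Site d → Fin d → 𝔸ˣ, mgauge U₀ u W = U' ∧ (1 ≤ m → Lan m W) ∧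
        ∃ A : Site d → Fin d → 𝔸, ∀ j, j ≤ m → ∀ b ∈ E j,
          W b.1 b.2 = cfgExp η A b.1 b.2 ∧ IsSelfAdjoint (A b.1 b.2) ∧ ‖A b.1 b.2‖ ≤ cstar * ((L : ℝ) ^ j * η)⁻¹ :=
  thm4_exists_all_levels_supp_bdry_mem_R129 hL1 hη S G hG hU₀ hU' hcstar hα₄ hs₁ hs₂ ha ha2 E hE h66
    (fun m u => Restr129Z L m (Λs m) U₀ u) (restr129Z_one L 0 (Λs 0) U₀) Lan hP5base hP5 hP3

/-- ★★ **THEOREM 4's LEVEL INDUCTION WITH THE SUPPORT INVARIANT, RECORD STRUCTURE** (twin of ✓`B8Thm4SupportLocalBdry.thm4_exists_all_levels_supp_bdry`,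
unitary gauge transformations = the `G := U(𝔸)` case of the preceding, (1.29) = `Restr129Z`): the form the dented record crown's road reads (engine:
`B8Thm4KLevelGamma` over this theorem's engine twin). [cite: Balaban1985RegularSpaces, Thm 4 p.88, proof pp.88–89 + 94–95, Prop. 5 (1.107)–(1.108) p.94, Prop. 3 p.87, (1.17) p.78, (1.29) p.81; Balaban1987RG1, pp.253–254] -/
theorem thm4_exists_all_levels_supp_bdry (hL1 : 1 ≤ L) (hη : 0 < η) (S : Set (Site d))
    (hU₀ : ∀ x κ, U₀ x κ ∈ unitaryUnits 𝔸) (hU' : ∀ x κ, U' x κ ∈ unitaryUnits 𝔸)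
    (hcstar : 0 ≤ cstar) (hα₄ : 0 ≤ α₄) (hs₁ : α₄ ≤ 1 / 84) (hs₂ : L * cstar ≤ 1 / 12) (ha : a ≤ 1 / 4) (ha2 : 2 * a ≤ cstar)
    (E : ℕ → Set (Site d × Fin d)) (hE : ∀ j, E (j + 1) ⊆ E j)
    (h66 : ∀ b ∈ E 0, ‖((U' b.1 b.2 : 𝔸ˣ) : 𝔸) - 1‖ ≤ a)
    (Λs : ℕ → ℕ → Set (Site d)) (Lan : ℕ → (Site d → Fin d → 𝔸ˣ) → Prop)
    (hP5base : ∃ (v : Site d → 𝔸ˣ) (lam : Site d → 𝔸), (∀ x, v x ∈ unitaryUnits 𝔸) ∧ (∀ x, x ∉ S → v x = 1) ∧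
        (∀ j, j ≤ 1 → ∀ b ∈ E j, (v b.1 : 𝔸) = ((gaugeExp lam b.1 : 𝔸ˣ) : 𝔸) ∧
          (v (b.1 + e b.2) : 𝔸) = ((gaugeExp lam (b.1 + e b.2) : 𝔸ˣ) : 𝔸)) ∧
        (∀ j, j ≤ 1 → ∀ b ∈ E j, ‖lam b.1‖ ≤ α₄ ∧ ((L : ℝ) ^ j * η) * ‖covDerivFwd η U₀ b.2 lam b.1‖ ≤ α₄) ∧
        Lan 1 (mgauge U₀ v⁻¹ U') ∧ Restr129Z L 1 (Λs 1) U₀ ((1 : Site d → 𝔸ˣ) * v))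
    (hP5 : ∀ m, 1 ≤ m → m < k → ∀ (u₁ : Site d → 𝔸ˣ) (U₁ : Site d → Fin d → 𝔸ˣ) (A : Site d → Fin d → 𝔸),
      (∀ x, u₁ x ∈ unitaryUnits 𝔸) → (∀ x, x ∉ S → u₁ x = 1) → mgauge U₀ u₁ U₁ = U' → Restr129Z L m (Λs m) U₀ u₁ → Lan m U₁ →
      (∀ j, j ≤ m → ∀ b ∈ E j, U₁ b.1 b.2 = cfgExp η A b.1 b.2 ∧ IsSelfAdjoint (A b.1 b.2) ∧ ‖A b.1 b.2‖ ≤ cstar * ((L : ℝ) ^ j * η)⁻¹) →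
      ∃ (v : Site d → 𝔸ˣ) (lam : Site d → 𝔸), (∀ x, v x ∈ unitaryUnits 𝔸) ∧ (∀ x, x ∉ S → v x = 1) ∧
        (∀ j, j ≤ m + 1 → ∀ b ∈ E j, (v b.1 : 𝔸) = ((gaugeExp lam b.1 : 𝔸ˣ) : 𝔸) ∧
          (v (b.1 + e b.2) : 𝔸) = ((gaugeExp lam (b.1 + e b.2) : 𝔸ˣ) : 𝔸)) ∧
        (∀ j, j ≤ m + 1 → ∀ b ∈ E j, ‖lam b.1‖ ≤ α₄ ∧ ((L : ℝ) ^ j * η) * ‖covDerivFwd η U₀ b.2 lam b.1‖ ≤ α₄) ∧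
        Lan (m + 1) (mgauge U₀ v⁻¹ U₁) ∧ Restr129Z L (m + 1) (Λs (m + 1)) U₀ (u₁ * v))
    (hP3 : ∀ m, 1 ≤ m → m ≤ k → ∀ (u : Site d → 𝔸ˣ) (W : Site d → Fin d → 𝔸ˣ) (A : Site d → Fin d → 𝔸),
      (∀ x, u x ∈ unitaryUnits 𝔸) → (∀ x, x ∉ S → u x = 1) → mgauge U₀ u W = U' → Restr129Z L m (Λs m) U₀ u → Lan m W →
      (∀ j, j ≤ m → ∀ b ∈ E j, W b.1 b.2 = cfgExp η A b.1 b.2 ∧ ‖A b.1 b.2‖ ≤ (2 * (L * cstar) + 8 * α₄) * ((L : ℝ) ^ j * η)⁻¹) →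
      ∀ j, j ≤ m → ∀ b ∈ E j, ‖A b.1 b.2‖ ≤ cstar * ((L : ℝ) ^ j * η)⁻¹) :
    ∀ m, m ≤ k → ∃ u : Site d → 𝔸ˣ, (∀ x, u x ∈ unitaryUnits 𝔸) ∧ (∀ x, x ∉ S → u x = 1) ∧ Restr129Z L m (Λs m) U₀ u ∧
      ∃ W : Site d → Fin d → 𝔸ˣ, mgauge U₀ u W = U' ∧ (1 ≤ m → Lan m W) ∧
        ∃ A : Site d → Fin d → 𝔸, ∀ j, j ≤ m → ∀ b ∈ E j,
          W b.1 b.2 = cfgExp η A b.1 b.2 ∧ IsSelfAdjoint (A b.1 b.2) ∧ ‖A b.1 b.2‖ ≤ cstar * ((L : ℝ) ^ j * η)⁻¹ :=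
  thm4_exists_all_levels_supp_bdry_mem_R129 hL1 hη S (unitaryUnits 𝔸) le_rfl hU₀ hU' hcstar hα₄ hs₁ hs₂ ha ha2 E hE h66
    (fun m u => Restr129Z L m (Λs m) U₀ u) (restr129Z_one L 0 (Λs 0) U₀) Lan hP5base hP5 hP3

end Main

end Literature.MathematicalPhysics.QuantumFieldTheory.Balaban1983to89.B8Thm4SupportLocalBdryRec

end
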